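import Literature.NumberTheory.Transcendental.KZFibredRelations
import Literature.NumberTheory.Transcendental.KZDominatedFamily
import Summits.KontsevichZagierPeriods.KontsevichZagierPeriods.Theses.ValuedFieldSpecialisation

/-!
# Route ValuedFieldSpecialisation — posited objects: the subgroup of expandable classes

Route-posited definitions (D-0016 `<Route>Defs.lean`) for the items `ClassLevelExpansion`
(stmt-KontsevichZagierPeriods-3496, crux) and `ClassLevelExpansionFibreDimOne`
(stmt-KontsevichZagierPeriods-3503, support) of route ValuedFieldSpecialisation. Both items say,
for a family `R` (an `(n+1)`-dimensional integral representation read over `s = z 0`), that the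
class `[R] ∈ KZ.FormalRep` is congruent modulo the FIBRED relations `KZ.fibredRelations` to a
`ℤ`-combination of ELEMENTARY DIVERGENT PRODUCT families plus a `ℤ`-combination of DOMINATED
families (`KZ.IsDominatedFamily`). This file names the two generator sets — each is VERBATIM the
clause of the items for one index — and the subgroup they generate together with the fibred
relations:

* `elementaryGenerators` — the classes `[P]` of the elementary divergent products
  `P = {(s, u, y, w) | 0 < s < 1, 0 < u, u^q s^p < 1, s ≤ y_j ≤ 1, w ∈ r.domain}` with integrand
  `∏ y_j⁻¹ · r.integrand w` (`0 < q`, and `0 < p` or `0 < b`), whose slice over `s` has value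
  `s^{-p/q} (log 1/s)^b · r.value`;
* `dominatedGenerators` — the classes `[S]` of dominated families;
* `expandable := fibredRelations ⊔ closure elementaryGenerators ⊔ closure dominatedGenerators`.

Main statements: `mem_closure_elementaryGenerators_iff`, `mem_closure_dominatedGenerators_iff`
(closure membership is the items' literal `Fin k`-indexed `ℤ`-combination shape, by
`Submodule.mem_span_set'` over `ℤ`), `exists_expansion_iff_mem_expandable`, and the
reformulations `classLevelExpansionFibreDimOne_iff` / `classLevelExpansion_iff`:
the items hold iff `[R] ∈ expandable` for every family `R` of the stated dimension. Every partial
result toward the items is thereby a membership in ONE subgroup (closed under the group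
operations, containing the fibred relations, the dominated and the elementary classes).

Sources: M. Kontsevich, D. Zagier, *Periods* (2001), §1.2; G. Comte, J.-M. Lion, J.-P. Rolin,
*Nature log-analytique du volume des sous-analytiques*, Illinois J. Math. 44 (2000) (the
log-power monomials `s^a (log s)^b` that the elementary products realise as classes). The objects
are this route's (not in print). Deliberately NOT here: any claim that a given family is
expandable (the items themselves).
-/

noncomputable section

namespace Summit.KontsevichZagierPeriods.ValuedFieldSpecialisation

open MeasureTheory Set Filter
open scoped Topology
open Literature.NumberTheory.Transcendental Literature.NumberTheory.Transcendental.KZ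

/-- **Elementary divergent product generators** (route ValuedFieldSpecialisation, items
`ClassLevelExpansion`/`ClassLevelExpansionFibreDimOne`, verbatim their clause for one index): the
classes `[P]` of the representations `P` of dimension `b + d + 2` in coordinates
`(s, u, y₁, …, y_b, w₁, …, w_d)` with domain `0 < s < 1`, `0 < u`, `u ^ q * s ^ p < 1`,
`s ≤ y_j ≤ 1`, `w ∈ r.domain` and integrand `(∏ j, (y_j)⁻¹) * r.integrand w`, for natural numbers
`p q b d` with `0 < q` and (`0 < p` or `0 < b`) and any representation `r` of dimension `d`. The
slice of `P` over `s ∈ (0, 1)` has value `s ^ (-p/q) * (log (1/s)) ^ b * r.value`: these classes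
realise the divergent log-power monomials of Comte–Lion–Rolin expansions.
[Comte–Lion–Rolin 2000, Thm. 1 (the monomials); this route (the classes)] [folklore] -/
def elementaryGenerators : Set FormalRep :=
  {x : FormalRep | ∃ (p q b d : ℕ) (r : IntegralRep d) (P : IntegralRep (b + d + 1 + 1)),
    0 < q ∧ (0 < p ∨ 0 < b) ∧
    P.domain = {z | ∃ (s u : ℝ) (y : Fin b → ℝ) (w : Fin d → ℝ),
      z = Matrix.vecCons s (Matrix.vecCons u (Fin.append y w)) ∧ 0 < s ∧ s < 1 ∧ 0 < u ∧
        u ^ q * s ^ p < 1 ∧ (∀ j, s ≤ y j ∧ y j ≤ 1) ∧ w ∈ r.domain} ∧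
    P.integrand = (fun z => (∏ j : Fin b, (z (Fin.castAdd d j).succ.succ)⁻¹) *
      r.integrand (fun l : Fin d => z (Fin.natAdd b l).succ.succ)) ∧
    x = of P}

/-- **Dominated generators** (route ValuedFieldSpecialisation, verbatim the dominated clause of its
items): the classes `[S]` of the dominated families `S` (`KZ.IsDominatedFamily S r₀ g`: uniformly
dominated near `s = 0⁺` by an integrable envelope `g`, with a.e. special fibre `r₀`). [folklore] -/
def dominatedGenerators : Set FormalRep :=
  {x : FormalRep | ∃ (d : ℕ) (S : IntegralRep (d + 1)) (r₀ g : IntegralRep d),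
    IsDominatedFamily S r₀ g ∧ x = of S}

/-- **The subgroup of expandable classes** (route ValuedFieldSpecialisation): the join of the fibred
relations `KZ.fibredRelations`, the subgroup generated by the elementary divergent products and
the subgroup generated by the dominated families. The items `ClassLevelExpansion(FibreDimOne)`
say exactly that `[R] ∈ expandable` for every family `R` (`classLevelExpansion_iff`,
`classLevelExpansionFibreDimOne_iff`). [folklore] -/
def expandable : AddSubgroup FormalRep :=
  fibredRelations ⊔ AddSubgroup.closure elementaryGenerators ⊔
    AddSubgroup.closure dominatedGenerators

/-- Unfolding `elementaryGenerators` (definitional). [folklore] -/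
theorem mem_elementaryGenerators_iff {x : FormalRep} :
    x ∈ elementaryGenerators ↔ ∃ (p q b d : ℕ) (r : IntegralRep d) (P : IntegralRep (b + d + 1 + 1)),
      0 < q ∧ (0 < p ∨ 0 < b) ∧
      P.domain = {z | ∃ (s u : ℝ) (y : Fin b → ℝ) (w : Fin d → ℝ),
        z = Matrix.vecCons s (Matrix.vecCons u (Fin.append y w)) ∧ 0 < s ∧ s < 1 ∧ 0 < u ∧
          u ^ q * s ^ p < 1 ∧ (∀ j, s ≤ y j ∧ y j ≤ 1) ∧ w ∈ r.domain} ∧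
      P.integrand = (fun z => (∏ j : Fin b, (z (Fin.castAdd d j).succ.succ)⁻¹) *
        r.integrand (fun l : Fin d => z (Fin.natAdd b l).succ.succ)) ∧
      x = of P :=
  Iff.rfl

/-- Unfolding `dominatedGenerators` (definitional). [folklore] -/
theorem mem_dominatedGenerators_iff {x : FormalRep} :
    x ∈ dominatedGenerators ↔ ∃ (d : ℕ) (S : IntegralRep (d + 1)) (r₀ g : IntegralRep d),
      IsDominatedFamily S r₀ g ∧ x = of S :=
  Iff.rfl

/-- Unfolding `expandable` (definitional). [folklore] -/
theorem expandable_def :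
    expandable = fibredRelations ⊔ AddSubgroup.closure elementaryGenerators ⊔
      AddSubgroup.closure dominatedGenerators :=
  rfl

/-- Closure membership for the elementary generators is the item's literal `∃`-shape for `D`
(`ℤ`-span = subgroup closure, `Submodule.mem_span_set'`). [folklore] -/
theorem mem_closure_elementaryGenerators_iff (D : FormalRep) :
    D ∈ AddSubgroup.closure elementaryGenerators ↔
      ∃ (k : ℕ) (m : Fin k → ℤ) (p q b d : Fin k → ℕ) (r : (i : Fin k) → IntegralRep (d i))
        (P : (i : Fin k) → IntegralRep (b i + d i + 1 + 1)),
        (∀ i, 0 < q i ∧ (0 < p i ∨ 0 < b i) ∧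
          (P i).domain = {z | ∃ (s u : ℝ) (y : Fin (b i) → ℝ) (w : Fin (d i) → ℝ),
            z = Matrix.vecCons s (Matrix.vecCons u (Fin.append y w)) ∧ 0 < s ∧ s < 1 ∧ 0 < u ∧
              u ^ (q i) * s ^ (p i) < 1 ∧ (∀ j, s ≤ y j ∧ y j ≤ 1) ∧ w ∈ (r i).domain} ∧
          (P i).integrand = fun z => (∏ j : Fin (b i), (z (Fin.castAdd (d i) j).succ.succ)⁻¹) *
            (r i).integrand (fun l : Fin (d i) => z (Fin.natAdd (b i) l).succ.succ)) ∧
        D = ∑ i, m i • of (P i) := by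
  constructor
  · intro hD
    rw [← Submodule.span_int_eq_addSubgroupClosure, Submodule.mem_toAddSubgroup] at hD
    obtain ⟨k, m, g, rfl⟩ := Submodule.mem_span_set'.mp hD
    choose p q b d r P hq hpb hdom hint hg using fun i => (g i).2
    exact ⟨k, m, p, q, b, d, r, P, fun i => ⟨hq i, hpb i, hdom i, hint i⟩,
      Finset.sum_congr rfl fun i _ => by rw [hg i]⟩
  · rintro ⟨k, m, p, q, b, d, r, P, hP, rfl⟩
    refine AddSubgroup.sum_mem _ fun i _ => AddSubgroup.zsmul_mem _ (AddSubgroup.subset_closure ?_) _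
    exact ⟨p i, q i, b i, d i, r i, P i, (hP i).1, (hP i).2.1, (hP i).2.2.1, (hP i).2.2.2, rfl⟩

/-- Closure membership for the dominated generators is the item's literal `∃`-shape for `G`.
[folklore] -/
theorem mem_closure_dominatedGenerators_iff (G : FormalRep) :
    G ∈ AddSubgroup.closure dominatedGenerators ↔
      ∃ (k : ℕ) (d : Fin k → ℕ) (m : Fin k → ℤ) (S : (i : Fin k) → IntegralRep (d i + 1))
        (r₀ g : (i : Fin k) → IntegralRep (d i)),
        (∀ i, IsDominatedFamily (S i) (r₀ i) (g i)) ∧ G = ∑ i, m i • of (S i) := by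
  constructor
  · intro hG
    rw [← Submodule.span_int_eq_addSubgroupClosure, Submodule.mem_toAddSubgroup] at hG
    obtain ⟨k, m, gen, rfl⟩ := Submodule.mem_span_set'.mp hG
    choose d S r₀ g hS hgen using fun i => (gen i).2
    exact ⟨k, d, m, S, r₀, g, hS, Finset.sum_congr rfl fun i _ => by rw [hgen i]⟩
  · rintro ⟨k, d, m, S, r₀, g, hS, rfl⟩
    refine AddSubgroup.sum_mem _ fun i _ => AddSubgroup.zsmul_mem _ (AddSubgroup.subset_closure ?_) _
    exact ⟨d i, S i, r₀ i, g i, hS i, rfl⟩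

/-- **The expansion statement for one class is a membership**: the literal conclusion of the item
for `x : FormalRep` (elementary `D`, dominated `G`, `x − D − G ∈ fibredRelations`) holds iff
`x ∈ expandable`. [folklore] -/
theorem exists_expansion_iff_mem_expandable (x : FormalRep) :
    (∃ (D G : FormalRep),
      (∃ (k : ℕ) (m : Fin k → ℤ) (p q b d : Fin k → ℕ) (r : (i : Fin k) → IntegralRep (d i))
        (P : (i : Fin k) → IntegralRep (b i + d i + 1 + 1)),
        (∀ i, 0 < q i ∧ (0 < p i ∨ 0 < b i) ∧
          (P i).domain = {z | ∃ (s u : ℝ) (y : Fin (b i) → ℝ) (w : Fin (d i) → ℝ),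
            z = Matrix.vecCons s (Matrix.vecCons u (Fin.append y w)) ∧ 0 < s ∧ s < 1 ∧ 0 < u ∧
              u ^ (q i) * s ^ (p i) < 1 ∧ (∀ j, s ≤ y j ∧ y j ≤ 1) ∧ w ∈ (r i).domain} ∧
          (P i).integrand = fun z => (∏ j : Fin (b i), (z (Fin.castAdd (d i) j).succ.succ)⁻¹) *
            (r i).integrand (fun l : Fin (d i) => z (Fin.natAdd (b i) l).succ.succ)) ∧
        D = ∑ i, m i • of (P i)) ∧
      (∃ (k : ℕ) (d : Fin k → ℕ) (m : Fin k → ℤ) (S : (i : Fin k) → IntegralRep (d i + 1))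
        (r₀ g : (i : Fin k) → IntegralRep (d i)),
        (∀ i, IsDominatedFamily (S i) (r₀ i) (g i)) ∧ G = ∑ i, m i • of (S i)) ∧
      x - D - G ∈ fibredRelations) ↔
    x ∈ expandable := by
  constructor
  · rintro ⟨D, G, hD, hG, hx⟩
    have hD' := (mem_closure_elementaryGenerators_iff D).mpr hD
    have hG' := (mem_closure_dominatedGenerators_iff G).mpr hG
    have : x = (x - D - G) + D + G := by abel
    rw [this]
    exact AddSubgroup.add_mem _ (AddSubgroup.add_mem _
      (AddSubgroup.mem_sup_left (AddSubgroup.mem_sup_left hx))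
      (AddSubgroup.mem_sup_left (AddSubgroup.mem_sup_right hD'))) (AddSubgroup.mem_sup_right hG')
  · intro hx
    obtain ⟨y, hy, G, hG, rfl⟩ := AddSubgroup.mem_sup.mp hx
    obtain ⟨f, hf, D, hD, rfl⟩ := AddSubgroup.mem_sup.mp hy
    refine ⟨D, G, (mem_closure_elementaryGenerators_iff D).mp hD, (mem_closure_dominatedGenerators_iff G).mp hG, ?_⟩
    have : f + D + G - D - G = f := by abel
    rwa [this]

/-- **Reformulation of the item**: `ClassLevelExpansionFibreDimOne` holds iff every
two-dimensional representation, read as a family over `z 0`, has an EXPANDABLE class: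
`[R] ∈ expandable`. (The closure inlined in the item is
`KZ.fibredRelations` and its dominated clause is `KZ.IsDominatedFamily`, both by `rfl`.)
[folklore] -/
theorem classLevelExpansionFibreDimOne_iff :
    Summit.KontsevichZagierPeriods.KontsevichZagierPeriods.Theses.ValuedFieldSpecialisation.ClassLevelExpansionFibreDimOne ↔
      ∀ R : IntegralRep (1 + 1), of R ∈ expandable := by
  unfold Summit.KontsevichZagierPeriods.KontsevichZagierPeriods.Theses.ValuedFieldSpecialisation.ClassLevelExpansionFibreDimOne
  exact forall_congr' fun R => exists_expansion_iff_mem_expandable (of R)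

/-- The same reformulation for the crux `ClassLevelExpansion` (all fibre dimensions).
[folklore] -/
theorem classLevelExpansion_iff :
    Summit.KontsevichZagierPeriods.KontsevichZagierPeriods.Theses.ValuedFieldSpecialisation.ClassLevelExpansion ↔
      ∀ (n : ℕ) (R : IntegralRep (n + 1)), of R ∈ expandable := by
  unfold Summit.KontsevichZagierPeriods.KontsevichZagierPeriods.Theses.ValuedFieldSpecialisation.ClassLevelExpansion
  exact forall_congr' fun n => forall_congr' fun R => exists_expansion_iff_mem_expandable (of R)

/-! ### Closure properties of the expandable classes -/

/-- Fibred relations are expandable. [folklore] -/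
theorem mem_expandable_of_mem_fibredRelations {x : FormalRep} (hx : x ∈ fibredRelations) :
    x ∈ expandable :=
  AddSubgroup.mem_sup_left (AddSubgroup.mem_sup_left hx)

/-- A dominated family is expandable. [folklore] -/
theorem of_mem_expandable_of_isDominatedFamily {d : ℕ} {S : IntegralRep (d + 1)}
    {r₀ g : IntegralRep d} (h : IsDominatedFamily S r₀ g) : of S ∈ expandable :=
  AddSubgroup.mem_sup_right (AddSubgroup.subset_closure (by exact ⟨d, S, r₀, g, h, rfl⟩))


/-- An elementary divergent product is expandable. [folklore] -/
theorem mem_expandable_of_mem_elementaryGenerators {x : FormalRep} (hx : x ∈ elementaryGenerators) :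
    x ∈ expandable :=
  AddSubgroup.mem_sup_left (AddSubgroup.mem_sup_right (AddSubgroup.subset_closure hx))

end Summit.KontsevichZagierPeriods.ValuedFieldSpecialisation
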